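import Mathlib.NumberTheory.Chebyshev
import Mathlib.Analysis.SpecialFunctions.Log.Basic
import Mathlib.Analysis.SpecificLimits.Basic
import Mathlib.Analysis.PSeries
import HarnessLib

/-!
# Chebyshev-strength bounds for sums of `1/p` over dyadic blocks and logarithmic windows

Topic `Literature/NumberTheory/LFunctions`. Everything in this file is PROVED (no `sorry`).

From Mathlib's Chebyshev bound `θ(x) ≤ (log 4) x` (`Chebyshev.theta_le_log4_mul_x`) we derive
the elementary "Mertens-strength up to constants" estimates for the weight `w(p) = 1/p` on the
primes, in exactly the shape consumed by the Karamata–Hardy–Littlewood Tauberian theorem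
`Literature.NumberTheory.LFunctions.HardyLittlewoodTauberianSums` (`KaramataTauberian.lean`, with `λ_n = log n`, `β = 0`):

* `card_blockPrimes_le`: `#{p prime : 2^j < p ≤ 2^{j+1}} ≤ 2^{j+2}/j` (`j ≥ 1`);
* `sum_blockPrimes_inv_le`: `Σ_{2^j < p ≤ 2^{j+1}} 1/p ≤ 4/j`;
* `tsum_invPrimeWeight_karamata_le` (**E1**): for `U ≥ 1`,
  `Σ_p (1/p) e^{-log p/U} (1 - e^{-log p/U}) ≤ 17`;
* `eventually_tsum_invPrimeWeight_window_le` (**E2**): for `0 < ε < 1/4` and all large `U`,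
  `Σ_{(1-ε)U ≤ log p ≤ (1+ε)U} 1/p ≤ 40 ε`.

These are the two "weight estimates" of Montgomery–Vaughan, *Multiplicative Number Theory I*,
p. 124, for the weight `1/p` on primes (there verified for `w(u) = A(u+1)^{β-1}`).

## References

* P. L. Chebyshev, Mémoire sur les nombres premiers, J. Math. Pures Appl. 17 (1852). [folklore]
* H. L. Montgomery, R. C. Vaughan, *Multiplicative Number Theory I*, CUP 2007, §2.2 and p. 124.
-/

noncomputable section

open Finset Real Filter
open scoped Topology Chebyshev

namespace Literature.NumberTheory.LFunctions

namespace PrimeReciprocal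

/-! ### Dyadic blocks of primes -/

/-- The primes in the dyadic block `(2^j, 2^{j+1}]`. [folklore] -/
def blockPrimes (j : ℕ) : Finset ℕ := (Ioc (2 ^ j) (2 ^ (j + 1))).filter Nat.Prime

/-- Auxiliary (proof-internal). [folklore] -/
lemma mem_blockPrimes {j p : ℕ} : p ∈ blockPrimes j ↔ (2 ^ j < p ∧ p ≤ 2 ^ (j + 1)) ∧ p.Prime := by
  simp [blockPrimes]

/-- **Chebyshev**: `#{p prime : 2^j < p ≤ 2^{j+1}} ≤ 2^{j+2}/j` for `j ≥ 1`. [folklore] -/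
lemma card_blockPrimes_le {j : ℕ} (hj : 1 ≤ j) :
    (#(blockPrimes j) : ℝ) ≤ 2 ^ (j + 2) / j := by
  have hL : 0 < Real.log 2 := Real.log_pos one_lt_two
  have hj0 : (0 : ℝ) < j := by exact_mod_cast hj
  -- θ(2^{j+1}) ≥ Σ_{block} log p ≥ card * (j log 2)
  have h1 : (#(blockPrimes j) : ℝ) * (j * Real.log 2) ≤ θ ((2 ^ (j + 1) : ℕ) : ℝ) := by
    rw [Chebyshev.theta_eq_sum_primesLE_log]
    calc (#(blockPrimes j) : ℝ) * (j * Real.log 2)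
        = ∑ p ∈ blockPrimes j, (j * Real.log 2 : ℝ) := by rw [sum_const, nsmul_eq_mul]
      _ ≤ ∑ p ∈ blockPrimes j, Real.log p := by
          refine sum_le_sum fun p hp => ?_
          obtain ⟨⟨hp1, -⟩, -⟩ := mem_blockPrimes.mp hp
          rw [← Real.log_pow, show ((2 : ℝ) ^ j) = ((2 ^ j : ℕ) : ℝ) by push_cast; ring]
          exact Real.log_le_log (by positivity) (by exact_mod_cast hp1.le)
      _ ≤ ∑ p ∈ Nat.primesLE (2 ^ (j + 1)), Real.log p := by
          refine sum_le_sum_of_subset_of_nonneg ?_ fun p hp _ => ?_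
          · intro p hp
            obtain ⟨⟨-, hp2⟩, hp3⟩ := mem_blockPrimes.mp hp
            exact Nat.mem_primesLE.mpr ⟨hp2, hp3⟩
          · exact Real.log_nonneg (by exact_mod_cast (Nat.mem_primesLE.mp hp).2.one_lt.le)
  have hlog4 : Real.log 4 = 2 * Real.log 2 := by
    rw [show (4 : ℝ) = 2 ^ 2 by norm_num, Real.log_pow]; norm_num
  have h2 : θ ((2 ^ (j + 1) : ℕ) : ℝ) ≤ 2 * Real.log 2 * 2 ^ (j + 1) :=
    calc θ ((2 ^ (j + 1) : ℕ) : ℝ) ≤ Real.log 4 * ((2 ^ (j + 1) : ℕ) : ℝ) :=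
          Chebyshev.theta_le_log4_mul_x (by positivity)
      _ = 2 * Real.log 2 * 2 ^ (j + 1) := by rw [hlog4]; push_cast; ring
  rw [le_div_iff₀ hj0]
  have h3 := h1.trans h2
  -- card * j * L ≤ 2 L 2^{j+1} = L * 2^{j+2}
  have : (#(blockPrimes j) : ℝ) * j * Real.log 2 ≤ 2 ^ (j + 2) * Real.log 2 := by
    calc (#(blockPrimes j) : ℝ) * j * Real.log 2 = #(blockPrimes j) * (j * Real.log 2) := by ring
      _ ≤ 2 * Real.log 2 * 2 ^ (j + 1) := h3
      _ = 2 ^ (j + 2) * Real.log 2 := by ring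
  exact le_of_mul_le_mul_right this hL

/-- A block sum is at most `M · 2^{j+2}/j` if its terms are at most `M ≥ 0`. [folklore] -/
lemma sum_blockPrimes_le {j : ℕ} (hj : 1 ≤ j) {f : ℕ → ℝ} {M : ℝ} (hM : 0 ≤ M)
    (hf : ∀ p ∈ blockPrimes j, f p ≤ M) :
    ∑ p ∈ blockPrimes j, f p ≤ M * (2 ^ (j + 2) / j) :=
  calc ∑ p ∈ blockPrimes j, f p ≤ ∑ p ∈ blockPrimes j, M := sum_le_sum hf
    _ = #(blockPrimes j) * M := by rw [sum_const, nsmul_eq_mul]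
    _ ≤ (2 ^ (j + 2) / j) * M := mul_le_mul_of_nonneg_right (card_blockPrimes_le hj) hM
    _ = M * (2 ^ (j + 2) / j) := mul_comm _ _

/-- `Σ_{2^j < p ≤ 2^{j+1}} 1/p ≤ 4/j` for `j ≥ 1`. [folklore] -/
lemma sum_blockPrimes_inv_le {j : ℕ} (hj : 1 ≤ j) :
    ∑ p ∈ blockPrimes j, (1 : ℝ) / p ≤ 4 / j := by
  have h := sum_blockPrimes_le hj (M := 1 / 2 ^ j) (f := fun p => (1 : ℝ) / p) (by positivity) ?_
  · calc ∑ p ∈ blockPrimes j, (1 : ℝ) / p ≤ 1 / 2 ^ j * (2 ^ (j + 2) / j) := h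
      _ = 4 / j := by field_simp; ring
  · intro p hp
    obtain ⟨⟨hp1, -⟩, -⟩ := mem_blockPrimes.mp hp
    have : (2 : ℝ) ^ j ≤ p := by exact_mod_cast hp1.le
    exact one_div_le_one_div_of_le (by positivity) this

/-- For a function vanishing off the primes, the sum over `(2^j, 2^{j+1}]` is the block sum.
[folklore] -/
lemma sum_Ioc_eq_sum_blockPrimes {f : ℕ → ℝ} (hf : ∀ n, ¬ n.Prime → f n = 0) (j : ℕ) :
    ∑ n ∈ Ioc (2 ^ j) (2 ^ (j + 1)), f n = ∑ p ∈ blockPrimes j, f p := by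
  rw [blockPrimes, sum_filter]
  refine sum_congr rfl fun n _ => ?_
  by_cases hn : n.Prime
  · rw [if_pos hn]
  · rw [if_neg hn, hf n hn]

/-- Decomposition of `(2^a, 2^b]` into dyadic blocks. [folklore] -/
lemma sum_Ioc_pow_eq_sum_blocks {f : ℕ → ℝ} (hf : ∀ n, ¬ n.Prime → f n = 0) {a b : ℕ}
    (hab : a ≤ b) :
    ∑ n ∈ Ioc (2 ^ a) (2 ^ b), f n = ∑ j ∈ Ico a b, ∑ p ∈ blockPrimes j, f p := by
  induction b, hab using Nat.le_induction with
  | base => simp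
  | succ b hb ih =>
    rw [sum_Ico_succ_top hb, ← ih, ← sum_Ioc_eq_sum_blockPrimes hf b,
      sum_Ioc_consecutive _ (Nat.pow_le_pow_right two_pos hb) (Nat.pow_le_pow_right two_pos b.le_succ)]

/-! ### The weight `1/p` on primes -/

/-- The weight `w(n) = 1/n` on primes, `0` elsewhere. [folklore] -/
def invPrimeWeight (n : ℕ) : ℝ := if n.Prime then 1 / n else 0

/-- Auxiliary (proof-internal). [folklore] -/
lemma invPrimeWeight_nonneg (n : ℕ) : 0 ≤ invPrimeWeight n := by
  unfold invPrimeWeight; split_ifs <;> positivity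

/-- Auxiliary (proof-internal). [folklore] -/
lemma invPrimeWeight_of_not_prime {n : ℕ} (hn : ¬ n.Prime) : invPrimeWeight n = 0 := if_neg hn

/-- Auxiliary (proof-internal). [folklore] -/
lemma invPrimeWeight_of_prime {n : ℕ} (hn : n.Prime) : invPrimeWeight n = 1 / n := if_pos hn

/-- Auxiliary (proof-internal). [folklore] -/
lemma invPrimeWeight_le (n : ℕ) : invPrimeWeight n ≤ 1 := by
  unfold invPrimeWeight
  split_ifs with h
  · exact (div_le_one (by exact_mod_cast h.pos)).mpr (by exact_mod_cast h.one_lt.le)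
  · exact zero_le_one

/-! ### Elementary exponential inequalities -/

/-- `1 - e^{-a} ≤ a`. [folklore] -/
lemma one_sub_exp_neg_le (a : ℝ) : 1 - Real.exp (-a) ≤ a := by
  have := Real.add_one_le_exp (-a); linarith

/-- `a/2 ≤ 1 - e^{-a}` for `0 ≤ a ≤ 1`. [folklore] -/
lemma half_le_one_sub_exp_neg {a : ℝ} (ha0 : 0 ≤ a) (ha1 : a ≤ 1) : a / 2 ≤ 1 - Real.exp (-a) := by
  -- e^{a} (1 - a/2) ≥ (1 + a)(1 - a/2) = 1 + a/2 - a²/2 ≥ 1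
  have h1 : 1 + a ≤ Real.exp a := by have := Real.add_one_le_exp a; linarith
  have h2 : 1 ≤ Real.exp a * (1 - a / 2) := by
    have : (1 : ℝ) ≤ (1 + a) * (1 - a / 2) := by nlinarith
    exact this.trans (mul_le_mul_of_nonneg_right h1 (by linarith))
  have h3 : Real.exp (-a) ≤ 1 - a / 2 := by
    rw [Real.exp_neg, inv_le_iff_one_le_mul₀ (Real.exp_pos a)]
    linarith [h2]
  linarith

/-- `2^y = e^{y log 2}` for `y : ℕ`. [folklore] -/
lemma two_pow_eq_exp (y : ℕ) : (2 : ℝ) ^ y = Real.exp (y * Real.log 2) := by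
  rw [Real.exp_nat_mul, Real.exp_log two_pos]

/-! ### E1: `Σ_p (1/p) x_p (1 - x_p) ≤ 17`, `x_p = e^{-log p / U}` -/

/-- The Karamata weight `x(1-x)` at `x_n = e^{-log n/U}`. [folklore] -/
def karamataKernel (U : ℝ) (n : ℕ) : ℝ :=
  Real.exp (-(Real.log n / U)) * (1 - Real.exp (-(Real.log n / U)))

/-- Auxiliary (proof-internal). [folklore] -/
lemma karamataKernel_nonneg {U : ℝ} (hU : 0 < U) (n : ℕ) : 0 ≤ karamataKernel U n := by
  unfold karamataKernel
  refine mul_nonneg (Real.exp_pos _).le ?_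
  rw [sub_nonneg, Real.exp_le_one_iff, neg_nonpos]
  exact div_nonneg (Real.log_natCast_nonneg n) hU.le

/-- Auxiliary (proof-internal). [folklore] -/
lemma karamataKernel_le_one {U : ℝ} (hU : 0 < U) (n : ℕ) : karamataKernel U n ≤ 1 := by
  unfold karamataKernel
  have h0 : 0 ≤ Real.log n / U := div_nonneg (Real.log_natCast_nonneg n) hU.le
  have h1 : Real.exp (-(Real.log n / U)) ≤ 1 := by
    rw [Real.exp_le_one_iff]; linarith
  have h2 : 0 ≤ 1 - Real.exp (-(Real.log n / U)) := by linarith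
  calc _ ≤ 1 * 1 := mul_le_mul h1 (by linarith [(Real.exp_pos (-(Real.log n / U)))]) h2 zero_le_one
    _ = 1 := one_mul 1

/-- On the block `(2^j, 2^{j+1}]` the kernel is at most `((j+1) log 2 / U) e^{-j log 2 / U}`.
[folklore] -/
lemma karamataKernel_le_of_mem_block {U : ℝ} (hU : 0 < U) {j p : ℕ} (hp : p ∈ blockPrimes j) :
    karamataKernel U p ≤ Real.exp (-(j * Real.log 2 / U)) * ((j + 1) * Real.log 2 / U) := by
  obtain ⟨⟨hp1, hp2⟩, hpp⟩ := mem_blockPrimes.mp hp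
  have hp0 : (0 : ℝ) < p := by exact_mod_cast hpp.pos
  have hlo : j * Real.log 2 ≤ Real.log p := by
    rw [← Real.log_pow]
    exact Real.log_le_log (by positivity) (by exact_mod_cast hp1.le)
  have hhi : Real.log p ≤ (j + 1) * Real.log 2 := by
    have h2 : ((j : ℝ) + 1) * Real.log 2 = Real.log ((2 : ℝ) ^ (j + 1)) := by
      rw [Real.log_pow]; push_cast; ring
    rw [h2]
    refine Real.log_le_log hp0 ?_
    exact_mod_cast hp2
  unfold karamataKernel
  refine mul_le_mul ?_ ?_ ?_ (Real.exp_pos _).le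
  · rw [Real.exp_le_exp, neg_le_neg_iff]
    exact div_le_div_of_nonneg_right hlo hU.le
  · calc 1 - Real.exp (-(Real.log p / U)) ≤ Real.log p / U := one_sub_exp_neg_le _
      _ ≤ (j + 1) * Real.log 2 / U := div_le_div_of_nonneg_right hhi hU.le
  · rw [sub_nonneg, Real.exp_le_one_iff, neg_nonpos]
    exact div_nonneg (Real.log_nonneg (by exact_mod_cast hpp.one_lt.le)) hU.le

/-- Block estimate for E1: `Σ_{block j} (1/p) x_p(1-x_p) ≤ (8 log 2 / U) r^j`, `r = e^{-log 2/U}`.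
[folklore] -/
lemma sum_blockPrimes_karamata_le {U : ℝ} (hU : 0 < U) {j : ℕ} (hj : 1 ≤ j) :
    ∑ p ∈ blockPrimes j, invPrimeWeight p * karamataKernel U p ≤
      (8 * Real.log 2 / U) * Real.exp (-(Real.log 2 / U)) ^ j := by
  have hL : 0 < Real.log 2 := Real.log_pos one_lt_two
  have hj0 : (0 : ℝ) < j := by exact_mod_cast hj
  set r : ℝ := Real.exp (-(Real.log 2 / U)) with hr
  have hrj : Real.exp (-(j * Real.log 2 / U)) = r ^ j := by
    rw [hr, ← Real.exp_nat_mul]; congr 1; ring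
  set M : ℝ := (1 / 2 ^ j) * (r ^ j * ((j + 1) * Real.log 2 / U)) with hM
  have hM0 : 0 ≤ M := by positivity
  have h := sum_blockPrimes_le hj (f := fun p => invPrimeWeight p * karamataKernel U p) hM0 ?_
  · refine h.trans ?_
    rw [hM]
    have : (1 : ℝ) / 2 ^ j * (r ^ j * ((j + 1) * Real.log 2 / U)) * (2 ^ (j + 2) / j) =
        (8 * Real.log 2 / U) * r ^ j * ((j + 1) / (2 * j)) := by
      field_simp; ring
    rw [this]
    have hfrac : ((j : ℝ) + 1) / (2 * j) ≤ 1 := by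
      rw [div_le_one (by positivity)]
      have : (1 : ℝ) ≤ j := by exact_mod_cast hj
      linarith
    calc (8 * Real.log 2 / U) * r ^ j * ((j + 1) / (2 * j))
        ≤ (8 * Real.log 2 / U) * r ^ j * 1 := by gcongr
      _ = (8 * Real.log 2 / U) * r ^ j := mul_one _
  · intro p hp
    obtain ⟨⟨hp1, -⟩, hpp⟩ := mem_blockPrimes.mp hp
    rw [invPrimeWeight_of_prime hpp, hM, ← hrj]
    refine mul_le_mul ?_ (karamataKernel_le_of_mem_block hU hp) (karamataKernel_nonneg hU p)
      (by positivity)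
    have : (2 : ℝ) ^ j ≤ p := by exact_mod_cast hp1.le
    exact one_div_le_one_div_of_le (by positivity) this

/-- Partial sums for E1 over `[0, 2^{J+1}]`. [folklore] -/
lemma sum_range_karamata_le {U : ℝ} (hU : 1 ≤ U) (J : ℕ) :
    ∑ n ∈ range (2 ^ (J + 1) + 1), invPrimeWeight n * karamataKernel U n ≤ 17 := by
  have hU0 : 0 < U := by linarith
  have hL : 0 < Real.log 2 := Real.log_pos one_lt_two
  have hL1 : Real.log 2 ≤ 1 := by
    rw [Real.log_le_iff_le_exp two_pos]
    have := Real.add_one_le_exp (1 : ℝ); linarith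
  set f : ℕ → ℝ := fun n => invPrimeWeight n * karamataKernel U n with hf
  have hf0 : ∀ n, 0 ≤ f n := fun n => mul_nonneg (invPrimeWeight_nonneg n) (karamataKernel_nonneg hU0 n)
  have hfp : ∀ n, ¬ n.Prime → f n = 0 := fun n hn => by
    simp [hf, invPrimeWeight_of_not_prime hn]
  -- split range (2^(J+1)+1) = range 3 ∪ Ioc 2 (2^(J+1))
  have hsplit : ∑ n ∈ range (2 ^ (J + 1) + 1), f n =
      ∑ n ∈ range (2 ^ 1 + 1), f n + ∑ n ∈ Ioc (2 ^ 1) (2 ^ (J + 1)), f n := by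
    rw [range_eq_Ico, range_eq_Ico]
    have h1 : (0 : ℕ) ≤ 2 ^ 1 + 1 := Nat.zero_le _
    have h2 : 2 ^ 1 + 1 ≤ 2 ^ (J + 1) + 1 := by
      have := Nat.pow_le_pow_right two_pos (Nat.le_add_left 1 J); omega
    rw [← sum_Ico_consecutive f h1 h2]
    have hI : Ico (2 ^ 1 + 1) (2 ^ (J + 1) + 1) = Ioc (2 ^ 1) (2 ^ (J + 1)) := by
      ext n; simp only [mem_Ico, mem_Ioc]; omega
    rw [hI]
  -- first part: f 0 + f 1 + f 2 ≤ 1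
  have hsmall : ∑ n ∈ range (2 ^ 1 + 1), f n ≤ 1 := by
    simp only [show 2 ^ 1 + 1 = 3 by norm_num, sum_range_succ, sum_range_zero, zero_add]
    have h0 : f 0 = 0 := hfp 0 Nat.not_prime_zero
    have h1 : f 1 = 0 := hfp 1 Nat.not_prime_one
    have h2 : f 2 ≤ 1 := by
      calc f 2 ≤ 1 * 1 := mul_le_mul (invPrimeWeight_le 2) (karamataKernel_le_one hU0 2)
            (karamataKernel_nonneg hU0 2) zero_le_one
        _ = 1 := one_mul 1
    linarith
  -- second part: sum of blocks
  have hblocks : ∑ n ∈ Ioc (2 ^ 1) (2 ^ (J + 1)), f n ≤ 16 := by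
    rw [sum_Ioc_pow_eq_sum_blocks hfp (Nat.le_add_left 1 J)]
    set r : ℝ := Real.exp (-(Real.log 2 / U)) with hr
    have hr0 : 0 ≤ r := (Real.exp_pos _).le
    have hr1 : r < 1 := by
      rw [hr, Real.exp_lt_one_iff]; exact neg_neg_of_pos (div_pos hL hU0)
    have h1r : Real.log 2 / U / 2 ≤ 1 - r := by
      apply half_le_one_sub_exp_neg (div_pos hL hU0).le
      rw [div_le_one hU0]; linarith
    calc ∑ j ∈ Ico 1 (J + 1), ∑ p ∈ blockPrimes j, f p
        ≤ ∑ j ∈ Ico 1 (J + 1), (8 * Real.log 2 / U) * r ^ j :=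
          sum_le_sum fun j hj => sum_blockPrimes_karamata_le hU0 (mem_Ico.mp hj).1
      _ = (8 * Real.log 2 / U) * ∑ j ∈ Ico 1 (J + 1), r ^ j := by rw [mul_sum]
      _ ≤ (8 * Real.log 2 / U) * (1 - r)⁻¹ := by
          refine mul_le_mul_of_nonneg_left ?_ (by positivity)
          calc ∑ j ∈ Ico 1 (J + 1), r ^ j ≤ ∑' j : ℕ, r ^ j :=
                (summable_geometric_of_lt_one hr0 hr1).sum_le_tsum _ (fun j _ => pow_nonneg hr0 j)
            _ = (1 - r)⁻¹ := tsum_geometric_of_lt_one hr0 hr1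
      _ ≤ (8 * Real.log 2 / U) * (Real.log 2 / U / 2)⁻¹ := by
          refine mul_le_mul_of_nonneg_left ?_ (by positivity)
          exact inv_anti₀ (by positivity) h1r
      _ = 16 := by field_simp; ring
  rw [hsplit]
  linarith

/-- **E1.** For `U ≥ 1`: `Σ_p (1/p) e^{-log p/U}(1 - e^{-log p/U}) ≤ 17`. [folklore] -/
theorem tsum_invPrimeWeight_karamata_le {U : ℝ} (hU : 1 ≤ U) :
    ∑' n : ℕ, invPrimeWeight n *
      (Real.exp (-(Real.log n / U)) * (1 - Real.exp (-(Real.log n / U)))) ≤ 17 := by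
  have hU0 : 0 < U := by linarith
  change ∑' n : ℕ, invPrimeWeight n * karamataKernel U n ≤ 17
  refine Real.tsum_le_of_sum_range_le
    (fun n => mul_nonneg (invPrimeWeight_nonneg n) (karamataKernel_nonneg hU0 n)) fun N => ?_
  -- range N ⊆ range (2^(N+1)+1)
  calc ∑ n ∈ range N, invPrimeWeight n * karamataKernel U n
      ≤ ∑ n ∈ range (2 ^ (N + 1) + 1), invPrimeWeight n * karamataKernel U n := by
        refine sum_le_sum_of_subset_of_nonneg (range_subset_range.mpr ?_)
          fun n _ _ => mul_nonneg (invPrimeWeight_nonneg n) (karamataKernel_nonneg hU0 n)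
        have : N < 2 ^ N := Nat.lt_two_pow_self
        have : 2 ^ N ≤ 2 ^ (N + 1) := Nat.pow_le_pow_right two_pos N.le_succ
        omega
    _ ≤ 17 := sum_range_karamata_le hU N

/-- Summability of the E1 series (all `U > 0`). [folklore] -/
theorem summable_invPrimeWeight_mul_exp {δ : ℝ} (hδ : 0 < δ) :
    Summable fun n : ℕ => invPrimeWeight n * Real.exp (-(δ * Real.log n)) := by
  refine Summable.of_nonneg_of_le (fun n => mul_nonneg (invPrimeWeight_nonneg n) (Real.exp_pos _).le)
    (fun n => ?_) ((Real.summable_nat_rpow_inv (p := 1 + δ)).mpr (by linarith))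
  rcases Nat.eq_zero_or_pos n with rfl | hn
  · simp only [invPrimeWeight_of_not_prime Nat.not_prime_zero, zero_mul]; positivity
  · have hn0 : (0 : ℝ) < n := by exact_mod_cast hn
    have hexp : Real.exp (-(δ * Real.log n)) = ((n : ℝ) ^ δ)⁻¹ := by
      rw [Real.rpow_def_of_pos hn0, ← Real.exp_neg]; congr 1; ring
    rw [hexp, Real.rpow_add hn0, Real.rpow_one, mul_inv]
    refine mul_le_mul_of_nonneg_right ?_ (by positivity)
    calc invPrimeWeight n ≤ 1 / n := by
          unfold invPrimeWeight; split_ifs <;> [exact le_rfl; positivity]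
      _ = (n : ℝ)⁻¹ := one_div _

/-! ### E2: logarithmic windows -/

/-- **E2, block form.** For `1 ≤ a ≤ b`: `Σ_{2^a < p ≤ 2^b} 1/p ≤ 4 (b - a)/a`. [folklore] -/
lemma sum_Ioc_pow_invPrimeWeight_le {a b : ℕ} (ha : 1 ≤ a) (hab : a ≤ b) :
    ∑ n ∈ Ioc (2 ^ a) (2 ^ b), invPrimeWeight n ≤ 4 * (b - a) / a := by
  have ha0 : (0 : ℝ) < a := by exact_mod_cast ha
  rw [sum_Ioc_pow_eq_sum_blocks (fun n hn => invPrimeWeight_of_not_prime hn) hab]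
  calc ∑ j ∈ Ico a b, ∑ p ∈ blockPrimes j, invPrimeWeight p
      ≤ ∑ j ∈ Ico a b, (4 : ℝ) / a := by
        refine sum_le_sum fun j hj => ?_
        have hj := (mem_Ico.mp hj).1
        have hj1 : 1 ≤ j := ha.trans hj
        calc ∑ p ∈ blockPrimes j, invPrimeWeight p = ∑ p ∈ blockPrimes j, (1 : ℝ) / p :=
              sum_congr rfl fun p hp => invPrimeWeight_of_prime (mem_blockPrimes.mp hp).2
          _ ≤ 4 / j := sum_blockPrimes_inv_le hj1
          _ ≤ 4 / a := div_le_div_of_nonneg_left (by norm_num) ha0 (by exact_mod_cast hj)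
    _ = 4 * (b - a) / a := by
        rw [sum_const, Nat.card_Ico, nsmul_eq_mul, Nat.cast_sub hab]; ring

/-- **E2.** For `0 < ε < 1/4` and all large `U`:
`Σ_{(1-ε)U ≤ log p ≤ (1+ε)U} 1/p ≤ 40 ε`. [folklore] -/
theorem eventually_tsum_invPrimeWeight_window_le {ε : ℝ} (hε : 0 < ε) (hε4 : ε < 1 / 4) :
    ∀ᶠ U : ℝ in atTop, ∑' n : ℕ,
      (if (1 - ε) * U ≤ Real.log n ∧ Real.log n ≤ (1 + ε) * U then invPrimeWeight n else 0)
        ≤ 40 * ε := by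
  have hL : 0 < Real.log 2 := Real.log_pos one_lt_two
  filter_upwards [eventually_ge_atTop (8 * Real.log 2), eventually_ge_atTop (Real.log 2 / ε),
    eventually_gt_atTop (0 : ℝ)] with U hU8 hUε hU0
  set L := Real.log 2 with hLdef
  -- dyadic exponents: 2^{a} ≤ e^{(1-ε)U}/2,  e^{(1+ε)U} < 2^{b}
  set a : ℕ := ⌊(1 - ε) * U / L⌋₊ - 1 with ha
  set b : ℕ := ⌊(1 + ε) * U / L⌋₊ + 1 with hb
  have h1ε : 0 < 1 - ε := by linarith
  have hloA : (4 : ℝ) ≤ (1 - ε) * U / L - 2 := by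
    rw [le_sub_iff_add_le, le_div_iff₀ hL]; nlinarith
  have hfloorA : (1 - ε) * U / L - 1 ≤ (⌊(1 - ε) * U / L⌋₊ : ℝ) :=
    (Nat.sub_one_lt_floor _).le
  have hfloorA' : (⌊(1 - ε) * U / L⌋₊ : ℝ) ≤ (1 - ε) * U / L := Nat.floor_le (by positivity)
  have hApos : 1 ≤ ⌊(1 - ε) * U / L⌋₊ := by
    have : (1 : ℝ) ≤ ⌊(1 - ε) * U / L⌋₊ := by linarith
    exact_mod_cast this
  have haR : (a : ℝ) = ⌊(1 - ε) * U / L⌋₊ - 1 := by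
    rw [ha, Nat.cast_sub hApos, Nat.cast_one]
  have ha_ge : (1 - ε) * U / L - 2 ≤ a := by rw [haR]; linarith
  have ha4 : (4 : ℝ) ≤ a := hloA.trans ha_ge
  have ha1 : 1 ≤ a := by
    have : (1 : ℝ) ≤ a := by linarith
    exact_mod_cast this
  have hbR : (b : ℝ) = ⌊(1 + ε) * U / L⌋₊ + 1 := by rw [hb]; push_cast; ring
  have hb_le : (b : ℝ) ≤ (1 + ε) * U / L + 1 := by
    rw [hbR]; linarith [Nat.floor_le (show 0 ≤ (1 + ε) * U / L by positivity)]
  have hb_gt : (1 + ε) * U / L < b := by rw [hbR]; exact Nat.lt_floor_add_one _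
  have hab : a ≤ b := by
    have : (a : ℝ) ≤ b := by
      rw [haR, hbR]
      have : (⌊(1 - ε) * U / L⌋₊ : ℝ) ≤ ⌊(1 + ε) * U / L⌋₊ := by
        exact_mod_cast Nat.floor_le_floor (by
          apply div_le_div_of_nonneg_right _ hL.le; nlinarith)
      linarith
    exact_mod_cast this
  -- the window is contained in Ioc (2^a) (2^b)
  have hwindow : ∀ n : ℕ, (1 - ε) * U ≤ Real.log n ∧ Real.log n ≤ (1 + ε) * U →
      n ∈ Ioc (2 ^ a) (2 ^ b) := by
    rintro n ⟨hlo, hhi⟩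
    have hn0 : 0 < n := by
      rcases Nat.eq_zero_or_pos n with rfl | h
      · exfalso; simp at hlo; nlinarith
      · exact h
    have hnR : (0 : ℝ) < n := by exact_mod_cast hn0
    rw [mem_Ioc]
    constructor
    · -- 2^a < n : 2^(a+1) ≤ e^{(1-ε)U} ≤ n
      have h1 : ((2 ^ (a + 1) : ℕ) : ℝ) ≤ n := by
        push_cast
        rw [two_pow_eq_exp, ← Real.exp_log hnR]
        rw [Real.exp_le_exp]
        calc ((a + 1 : ℕ) : ℝ) * L ≤ ((1 - ε) * U / L) * L := by
              refine mul_le_mul_of_nonneg_right ?_ hL.le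
              push_cast; rw [haR]; linarith
          _ = (1 - ε) * U := by field_simp
          _ ≤ Real.log n := hlo
      have h2 : 2 ^ (a + 1) ≤ n := by exact_mod_cast h1
      have : 2 ^ a < 2 ^ (a + 1) := Nat.pow_lt_pow_right one_lt_two a.lt_succ_self
      omega
    · -- n ≤ 2^b : n ≤ e^{(1+ε)U} < 2^b
      have h1 : (n : ℝ) < ((2 ^ b : ℕ) : ℝ) := by
        push_cast
        rw [two_pow_eq_exp, ← Real.exp_log hnR, Real.exp_lt_exp]
        calc Real.log n ≤ (1 + ε) * U := hhi
          _ = ((1 + ε) * U / L) * L := by field_simp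
          _ < b * L := mul_lt_mul_of_pos_right hb_gt hL
      exact_mod_cast h1.le
  -- bound the tsum by finite sums
  have hnn : ∀ n : ℕ, 0 ≤ (if (1 - ε) * U ≤ Real.log n ∧ Real.log n ≤ (1 + ε) * U
      then invPrimeWeight n else 0) := fun n => by
    split_ifs <;> [exact invPrimeWeight_nonneg n; exact le_rfl]
  refine Real.tsum_le_of_sum_le hnn fun s => ?_
  calc ∑ n ∈ s, (if (1 - ε) * U ≤ Real.log n ∧ Real.log n ≤ (1 + ε) * U
          then invPrimeWeight n else 0)
      ≤ ∑ n ∈ Ioc (2 ^ a) (2 ^ b), invPrimeWeight n := by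
        rw [← sum_filter]
        refine sum_le_sum_of_subset_of_nonneg ?_ fun n _ _ => invPrimeWeight_nonneg n
        intro n hn
        exact hwindow n (mem_filter.mp hn).2
    _ ≤ 4 * (b - a) / a := sum_Ioc_pow_invPrimeWeight_le ha1 hab
    _ ≤ 40 * ε := by
        have ha0 : (0 : ℝ) < a := by linarith
        rw [div_le_iff₀ ha0]
        -- b - a ≤ 2εU/L + 3 and a ≥ (1-ε)U/L - 2 ≥ U/(2L)
        have hba : (b : ℝ) - a ≤ 2 * ε * U / L + 3 := by
          rw [haR]
          have : (b : ℝ) ≤ (1 + ε) * U / L + 1 := hb_le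
          have h3 : (1 - ε) * U / L - 1 ≤ (⌊(1 - ε) * U / L⌋₊ : ℝ) := hfloorA
          have : 2 * ε * U / L = (1 + ε) * U / L - (1 - ε) * U / L := by field_simp; ring
          linarith
        have haU : U / (2 * L) ≤ a := by
          have h1 : U / (2 * L) ≤ (1 - ε) * U / L - 2 := by
            rw [div_le_iff₀ (by positivity)]
            have : ((1 - ε) * U / L - 2) * (2 * L) = 2 * (1 - ε) * U - 4 * L := by
              field_simp; ring
            rw [this]
            nlinarith [mul_lt_mul_of_pos_right hε4 hU0]
          linarith
        -- 4(b-a) ≤ 8εU/L + 12 ≤ 40 ε a  since 40 ε a ≥ 40 ε U/(2L) = 20 ε U / L ≥ 8εU/L + 12 εU/L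
        -- and 12 ε U / L ≥ 12 (U ≥ L/ε)
        have hUε' : L ≤ ε * U := by rw [div_le_iff₀ hε] at hUε; linarith
        have h12 : (12 : ℝ) ≤ 12 * ε * U / L := by
          rw [le_div_iff₀ hL]; nlinarith
        calc 4 * ((b : ℝ) - a) ≤ 4 * (2 * ε * U / L + 3) := by gcongr
          _ = 8 * ε * U / L + 12 := by ring
          _ ≤ 8 * ε * U / L + 12 * ε * U / L := by linarith
          _ = 20 * ε * (U / L) := by ring
          _ = 40 * ε * (U / (2 * L)) := by field_simp; ring
          _ ≤ 40 * ε * a := by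
              refine mul_le_mul_of_nonneg_left haU (by positivity)

/-- Summability of the window series (it is a finite sum). [folklore] -/
theorem summable_invPrimeWeight_window (ε U : ℝ) :
    Summable fun n : ℕ =>
      (if (1 - ε) * U ≤ Real.log n ∧ Real.log n ≤ (1 + ε) * U then invPrimeWeight n else 0) := by
  apply summable_of_hasFiniteSupport
  refine (Set.finite_Iic ⌊Real.exp ((1 + ε) * U)⌋₊).subset ?_
  intro n hn
  rw [Function.mem_support] at hn
  simp only [Set.mem_Iic]
  by_contra h
  push Not at h
  apply hn
  have hn1 : Real.exp ((1 + ε) * U) < n := by exact_mod_cast Nat.lt_of_floor_lt h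
  have hnpos : (0 : ℝ) < n := lt_trans (Real.exp_pos _) hn1
  have : ¬ (Real.log n ≤ (1 + ε) * U) := fun h' => by
    have := Real.exp_le_exp.mpr h'; rw [Real.exp_log hnpos] at this; linarith
  simp [this]

end PrimeReciprocal

end Literature.NumberTheory.LFunctions
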